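import Summits.ResolutionOfSingularities.ResolutionOfSingularities.Theorems.WallCutRun2
import HarnessLib

/-!
# WallCutRun3 — decomp-res node «LossIsolation — second kernel file WallCutRun (lens-3 g25; critic rows 189/189c:
node CLEARED, this file landed at 0 as a tool)», tree file 3/3 of the node

Content VERBATIM from the decomp-res lens-3 g25 kernel file `HOME/decomp-res-lens-3/g25/WallCutRun.lean` (PIN
84202afa; imports the landed tree only, carries nothing); HOME = run/shared/lean/pub/decomp-res; critic
CRITIC-LEDGER rows 189/189c, landing order INBOX :1068 — provenance, critic text and the lens header in full in the
first file of the node, `WallCutRun`.  Namespace `…Theorems.WallCutRun`; `--supports stmt-ResolutionOfSingularities-27367`.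

## This file

Continuation 3/3 of `WallCutRun` (same namespace and sections of the node, cut at the tree's 400-line cap; section
variables / opens replayed): `section Layer` — carries `sharp_source`, `exists_token_le_of_thin`,
`exists_token_of_run_after_move`, `order_succ_add_le_of_axis_move`, `chart_switch_test`, `order_succ_le_of_unique_fibre`.

[WRITER NOTE (decomp-res writer g12): file split only (tree files ≤ 400 lines); namespace, sections, section
variables / opens and every declaration exactly as in the lens.]

(Sources: Hauser2010 (kangaroo points, oblique polynomials); HauserPerlega2019 §2; Moh1987; CossartPiltant2008 §2;
CossartJannsenSaito2020 Ch. 8; Hironaka2005 (order under permissible blow-up); Perlega2022 (residual order is not monotone).)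
-/

open MvPolynomial
open Literature.AlgebraicGeometry.Resolution
open Literature.AlgebraicGeometry.Resolution.Hauser2010
open Literature.AlgebraicGeometry.Resolution.PointBlowup
open Summit.ResolutionOfSingularities.ResolutionOfSingularities.Theorems.TightDefectClasses
open Summit.ResolutionOfSingularities.ResolutionOfSingularities.Theorems.TightDefectStrongWalks
open Summit.ResolutionOfSingularities.ResolutionOfSingularities.Theorems.ItineraryCutClasses
open Summit.ResolutionOfSingularities.ResolutionOfSingularities.Theorems.BoundaryLedger
open Summit.ResolutionOfSingularities.ResolutionOfSingularities.Theorems.ProximityCut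

namespace Summit.ResolutionOfSingularities.ResolutionOfSingularities.Theorems.WallCutRun

section Layer

variable {K : Type} [Field K] [DecidableEq K] {q : ℕ} {s₀ : State (Fin 3) K}

/-- **SHARP SOURCES (PROVED — the post-move LAYER STRUCTURE, unit-free).**  After ANY move at stage `t` (chart `j =
j_t`, any admissible
translation; `o = ordZero F_t = s + |r_t|`), below every monomial `e` of `F_{t+1}` there is an exponent `d″ ≤ e`
which is a monomial of
`F_{t+1}` unless it is a `q`-th power, lies over the new wall (`o − q ≤ d″_j`) and satisfies the UNIT-FREE LAYER BOUND
`σ_j(d″) + o ≤ |kept_t| + s + d″_j + q`, i.e. `σ_j(d″) ≤ |kept_t| + s + a` with `a = d″_j − m` its layer: the lost walls' unit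
`U = Π(u_i + b_i)^{r_i}` does not enter.  (The crude bound with `|r_t off j|` in place of `|kept_t|` holds for every
monomial.) [new] [folklore] -/
theorem sharp_source (hs : IsRoot q s₀) (W : ForcedWalk q s₀) (t : ℕ) {o s : ℕ}
    (ho : ordZero (W.st t).F = o) (hos : o = s + (W.st t).r.degree)
    {e : Fin 3 →₀ ℕ} (he : e ∈ (W.st (t + 1)).F.support) :
    ∃ d'' : Fin 3 →₀ ℕ, d'' ≤ e ∧ (¬ IsPthPowerExponent q d'' → d'' ∈ (W.st (t + 1)).F.support) ∧
      o - q ≤ d'' (W.j t) ∧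
      (Finsupp.erase (W.j t) d'').degree + o ≤ (kept W t).degree + s + d'' (W.j t) + q := by
  classical
  set j := W.j t with hjdef
  set A : Fin 3 →₀ ℕ := Finsupp.erase j (W.st t).r + Finsupp.single j (o - q) with hA
  set Q : MvPolynomial (Fin 3) K :=
    ∑ d ∈ (W.st t).F.support, monomial (chartExponent s j (d - (W.st t).r)) (coeff d (W.st t).F) with hQ
  set T := PointBlowup.translate (W.b t) (monomial A (1 : K)) with hT
  set Ps := PointBlowup.translate (W.b t) Q with hPs
  set α₀ : Fin 3 →₀ ℕ := Finsupp.filter (fun i => W.b t i = 0) A with hα₀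
  have hF1 : (W.st (t + 1)).F = deletePthPowers q (T * Ps) := by
    rw [st_succ_F, chartTransform_eq_monomial_mul hs W t ho hos, translate_mul]
  have hqo : q ≤ o := by
    have h := walk_ord hs W t
    rw [ho] at h
    exact_mod_cast h
  have hTle : ∀ α ∈ T.support, α₀ ≤ α := fun α hα => filter_le_of_mem_support_translate_monomial _ A hα
  have hT0 : α₀ ∈ T.support := filter_mem_support_translate_monomial _ (W.onExc t) A
  -- `e` is a monomial of `T * Ps`
  have he' : e ∈ (T * Ps).support := by
    have h0 := mem_support_iff.mp he
    rw [hF1, coeff_deletePthPowers] at h0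
    by_cases hP : IsPthPowerExponent q e
    · rw [if_pos hP] at h0
      exact absurd rfl h0
    · rw [if_neg hP] at h0
      exact mem_support_iff.mpr h0
  obtain ⟨ψ₀, hψ₀, hle, hmin⟩ := exists_minimal_add_le_of_mem_support_mul T Ps hTle he'
  refine ⟨α₀ + ψ₀, hle, ?_, ?_, ?_⟩
  · intro hnP
    rw [mem_support_iff, hF1, coeff_deletePthPowers, if_neg hnP, coeff_add_mul_of_minimal T Ps hTle hmin]
    exact mul_ne_zero (mem_support_iff.mp hT0) (mem_support_iff.mp hψ₀)
  · have h1 : α₀ j = o - q := by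
      rw [hα₀, Finsupp.filter_apply, if_pos (W.onExc t), hA, Finsupp.add_apply, Finsupp.erase_same,
        Finsupp.single_eq_same, zero_add]
    rw [Finsupp.add_apply, h1]
    exact Nat.le_add_right _ _
  · have h1 : α₀ j = o - q := by
      rw [hα₀, Finsupp.filter_apply, if_pos (W.onExc t), hA, Finsupp.add_apply, Finsupp.erase_same,
        Finsupp.single_eq_same, zero_add]
    have h2 : Finsupp.erase j α₀ = kept W t := by
      ext i
      unfold kept
      rw [← hjdef]
      by_cases hij : i = j
      · rw [hij, Finsupp.erase_same, Finsupp.erase_same]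
      · rw [Finsupp.erase_ne hij, Finsupp.erase_ne hij, hα₀, Finsupp.filter_apply, Finsupp.filter_apply, hA,
          Finsupp.add_apply, Finsupp.erase_ne hij, Finsupp.single_eq_of_ne hij, add_zero]
    have h3 := psi_support hs W t ho hos hψ₀
    rw [Finsupp.erase_add, map_add, h2, Finsupp.add_apply, h1]
    rw [← hjdef] at h3
    omega

/-- **TOKENS BELOW THIN MONOMIALS (PROVED — the pointwise form of (D4)).**  After ANY move at stage `t` (chart `j = j_t`,
`o = ordZero F_t = s + |r_t| > q`), if the next `k` moves are untranslated moves in a chart `i ≠ j` on a shade-`s`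
plateau, then below
every monomial `e` of `F_{t+1}` that is thin for `i` lies a TOKEN: a monomial `d″ ≤ e` of `F_{t+1}` over the new
wall (`o ≤ d″_j + q`), thin
for `i`, obeying the sharp layer bound (`sharp_source`) AND the horizon inequality of the run
(`run_horizon_ledger`).  The conjunction is the
explicit arithmetic region R(s, |kept_t|, kept_t(i), o, k, q). [new] [folklore] -/
theorem exists_token_le_of_thin (hs : IsRoot q s₀) (W : ForcedWalk q s₀) (t k : ℕ) {o s : ℕ}
    (ho : ordZero (W.st t).F = o) (hos : o = s + (W.st t).r.degree) (hqo : q < o)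
    {i : Fin 3} (hij : i ≠ W.j t)
    (hrun : ∀ l, l < k → W.j (t + 1 + l) = i ∧ W.b (t + 1 + l) = 0)
    (hsh : ∀ l, l ≤ k → (W.st (t + 1 + l)).shade = (s : ℕ∞))
    {e : Fin 3 →₀ ℕ} (he : e ∈ (W.st (t + 1)).F.support) (hthin : (Finsupp.erase i e).degree < q) :
    ∃ d'' : Fin 3 →₀ ℕ, d'' ≤ e ∧ d'' ∈ (W.st (t + 1)).F.support ∧ o ≤ d'' (W.j t) + q ∧ (Finsupp.erase i d'').degree < q ∧
      (Finsupp.erase (W.j t) d'').degree + o ≤ (kept W t).degree + s + d'' (W.j t) + q ∧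
      (s + (kept W t).degree + o) + k * (s + (Finsupp.erase i (kept W t)).degree + o) ≤
        d''.degree + k * (Finsupp.erase i d'').degree + (k + 1) * q := by
  classical
  obtain ⟨d, hde, hdsupp, hdj, hsharp⟩ := sharp_source hs W t ho hos he
  have hmono : Finsupp.erase i d ≤ Finsupp.erase i e := by
    intro x
    by_cases hx : x = i
    · rw [hx, Finsupp.erase_same, Finsupp.erase_same]
    · rw [Finsupp.erase_ne hx, Finsupp.erase_ne hx]
      exact hde x
  have hdi : (Finsupp.erase i d).degree < q := lt_of_le_of_lt (degree_le_degree_of_le hmono) hthin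
  have hdjq : d (W.j t) < q := by
    have h1 : (Finsupp.erase i d) (W.j t) ≤ (Finsupp.erase i d).degree := Finsupp.le_degree _ _
    rw [Finsupp.erase_ne (Ne.symm hij)] at h1
    omega
  have hnp : ¬ IsPthPowerExponent q d := by
    intro hP
    have h1 : q ∣ d (W.j t) := hP _ (Finsupp.mem_support_iff.mpr (by omega))
    have h2 := Nat.le_of_dvd (by omega) h1
    omega
  have hd1 := hdsupp hnp
  obtain ⟨o₁, ho₁, -⟩ := walk_nat hs W (t + 1)
  have hRH := run_horizon_ledger hs W hrun hsh ho₁ hd1 hdi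
  -- the ledger at stage `t + 1`
  obtain ⟨n, hn, hon⟩ := order_eq_shade_add_degree hs W (t + 1) ho₁
  have hns : n = s := by
    have h := hsh 0 (Nat.zero_le _)
    rw [Nat.add_zero, hn] at h
    exact_mod_cast h
  have hr1 := r_succ_eq W t ho
  have hdeg1 : (W.st (t + 1)).r.degree = (kept W t).degree + (o - q) := by
    rw [hr1, map_add, Finsupp.degree_single]
  have herase1 : Finsupp.erase i (W.st (t + 1)).r = Finsupp.erase i (kept W t) + Finsupp.single (W.j t) (o - q) := by
    rw [hr1]
    ext x
    by_cases hx : x = i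
    · rw [hx, Finsupp.erase_same, Finsupp.add_apply, Finsupp.erase_same, Finsupp.single_eq_of_ne hij, add_zero]
    · rw [Finsupp.erase_ne hx, Finsupp.add_apply, Finsupp.add_apply, Finsupp.erase_ne hx]
  have hdegE : (Finsupp.erase i (W.st (t + 1)).r).degree = (Finsupp.erase i (kept W t)).degree + (o - q) := by
    rw [herase1, map_add, Finsupp.degree_single]
  rw [hdegE] at hRH
  have h3 : k * (s + ((Finsupp.erase i (kept W t)).degree + (o - q))) + k * q =
      k * (s + (Finsupp.erase i (kept W t)).degree + o) := by
    rw [← Nat.mul_add]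
    congr 1
    omega
  have h4 : (k + 1) * q = k * q + q := by ring
  refine ⟨d, hde, hd1, by omega, hdi, hsharp, by omega⟩

/-- **THE FIRST-RUN SURVIVAL THEOREM (PROVED — (D4) of the run calculus as a citable criterion).**  In the situation of
`exists_token_le_of_thin`, `F_{t+1}` carries a SURVIVING TOKEN in the region R(s, |kept_t|, kept_t(i), o, k, q) —
for otherwise `F_{t+1}`
is fat off `i` and the top locus is not isolated (`PlanarCut.not_isolatedTop_of_fat`), contradicting
`ForcedWalk.isolated`.  R = ∅ is the
(D4) death test; |R| equals the engine's token count in every recorded case. [new] [folklore] -/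
theorem exists_token_of_run_after_move (hs : IsRoot q s₀) (W : ForcedWalk q s₀) (t k : ℕ) {o s : ℕ}
    (ho : ordZero (W.st t).F = o) (hos : o = s + (W.st t).r.degree) (hqo : q < o)
    {i : Fin 3} (hij : i ≠ W.j t)
    (hrun : ∀ l, l < k → W.j (t + 1 + l) = i ∧ W.b (t + 1 + l) = 0)
    (hsh : ∀ l, l ≤ k → (W.st (t + 1 + l)).shade = (s : ℕ∞)) :
    ∃ d'' : Fin 3 →₀ ℕ, d'' ∈ (W.st (t + 1)).F.support ∧ o ≤ d'' (W.j t) + q ∧ (Finsupp.erase i d'').degree < q ∧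
      (Finsupp.erase (W.j t) d'').degree + o ≤ (kept W t).degree + s + d'' (W.j t) + q ∧
      (s + (kept W t).degree + o) + k * (s + (Finsupp.erase i (kept W t)).degree + o) ≤
        d''.degree + k * (Finsupp.erase i d'').degree + (k + 1) * q := by
  classical
  by_cases hex : ∃ e ∈ (W.st (t + 1)).F.support, (Finsupp.erase i e).degree < q
  · obtain ⟨e, he, hthin⟩ := hex
    obtain ⟨d, -, hd⟩ := exists_token_le_of_thin hs W t k ho hos hqo hij hrun hsh he hthin
    exact ⟨d, hd⟩
  · push Not at hex
    exact absurd (W.isolated (t + 1)) (PlanarCut.not_isolatedTop_of_fat q i (W.st (t + 1)).F hex)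

/-- **THE ORDER TEST FOR AN UNTRANSLATED MOVE (PROVED).**  A move at the origin of chart `c` carries every monomial
`d` of `F_u` whose
chart image `d[c ↦ |d| − q]` is not a `q`-th power to a monomial of `F_{u+1}` with the same coefficient; hence
`ordZero F_{u+1} + q ≤ |d| + σ_c(d)`.  With the plateau ledger (`order_succ_of_axis`: `o_{u+1} + q = o_u + s + |r_u
off c|`) this is the
CHART-SWITCH TEST `o_u + s + |r_u off c| ≤ |d| + σ_c(d)` that every surviving token must pass at the end of a run
(the `k = 1` horizon
inequality without the thinness hypothesis). [new] [folklore] -/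
theorem order_succ_add_le_of_axis_move (hs : IsRoot q s₀) (W : ForcedWalk q s₀) (u : ℕ) {c : Fin 3} (hc : W.j u = c) (hb : W.b u = 0)
    {d : Fin 3 →₀ ℕ} (hd : d ∈ (W.st u).F.support) (hnP : ¬ IsPthPowerExponent q (chartExponent q c d))
    {o' : ℕ} (ho' : ordZero (W.st (u + 1)).F = o') :
    o' + q ≤ d.degree + (Finsupp.erase c d).degree := by
  classical
  have hdeg : q ≤ d.degree := le_degree_of_mem_support hs W u hd
  have hall : ∀ d' ∈ (W.st u).F.support, q ≤ d'.degree := fun d' hd' => le_degree_of_mem_support hs W u hd'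
  have hcoeff := coeff_chartTransform_chartExponent (q := q) (j := c) _ hall hd
  have hcF : coeff (chartExponent q c d) (W.st (u + 1)).F = coeff d (W.st u).F := by
    rw [st_succ_F_axis W u hc hb, coeff_deletePthPowers, if_neg hnP, hcoeff]
  have hmem : chartExponent q c d ∈ (W.st (u + 1)).F.support := by
    rw [mem_support_iff, hcF]
    exact mem_support_iff.mp hd
  have h1 := ord_le_degree_of_mem_support W (u + 1) ho' hmem
  have h2 := degree_chartExponent_add q c hdeg
  omega

/-- The chart-switch test in ledger form on a plateau: `o_u + s + |r_u off c| ≤ |d| + σ_c(d)` for every monomial `d`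
of `F_u` whose
chart-`c` image is not a `q`-th power, if the move at `u` is the untranslated move of chart `c` and the shade at `u
+ 1` is `s`. [new] [folklore] -/
theorem chart_switch_test (hs : IsRoot q s₀) (W : ForcedWalk q s₀) (u : ℕ) {c : Fin 3} (hc : W.j u = c) (hb : W.b u = 0)
    {s o : ℕ} (hsh : (W.st (u + 1)).shade = (s : ℕ∞)) (ho : ordZero (W.st u).F = o)
    {d : Fin 3 →₀ ℕ} (hd : d ∈ (W.st u).F.support) (hnP : ¬ IsPthPowerExponent q (chartExponent q c d)) :
    o + s + (Finsupp.erase c (W.st u).r).degree ≤ d.degree + (Finsupp.erase c d).degree := by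
  obtain ⟨o', ho', -⟩ := walk_nat hs W (u + 1)
  have h1 := order_succ_add_le_of_axis_move hs W u hc hb hd hnP ho'
  have h2 := order_succ_of_axis hs W u hc hb hsh ho ho'
  omega

/-- **THE ORDER TEST FOR A TRANSLATED MOVE (PROVED — fibre uniqueness).**  Move at stage `u` in chart `c` with translation `b`
(`b_c = 0`); `Z = {l : b_l = 0}`.  If a monomial `d` of `F_u` is the ONLY monomial of `F_u` whose chart image agrees
with `d[c ↦ |d| − q]`
on `Z` (its FIBRE is a singleton), then the floor monomial `M = d[c ↦ |d| − q]|_Z` (coordinates outside `Z` zeroed) survives in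
`F_{u+1}` with coefficient `c_d · Π_{l ∉ Z} b_l^{E_l} ≠ 0` — no other monomial can produce it — so `ordZero F_{u+1}
≤ |M|` unless `M` is a
`q`-th power.  This is the degree half of the deviation calculus (LEMMA E): a surviving token whose fibre is a
singleton bounds the next
order from above, against the plateau ledger from below. [new] [folklore] -/
theorem order_succ_le_of_unique_fibre (W : ForcedWalk q s₀) (u : ℕ) {c : Fin 3} (hc : W.j u = c)
    {d : Fin 3 →₀ ℕ} (hd : d ∈ (W.st u).F.support)
    (huniq : ∀ e ∈ (W.st u).F.support, (∀ l, W.b u l = 0 → chartExponent q c e l = chartExponent q c d l) → e = d)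
    (hnP : ¬ IsPthPowerExponent q (Finsupp.filter (fun l => W.b u l = 0) (chartExponent q c d)))
    {o' : ℕ} (ho' : ordZero (W.st (u + 1)).F = o') :
    o' ≤ (Finsupp.filter (fun l => W.b u l = 0) (chartExponent q c d)).degree := by
  classical
  set M := Finsupp.filter (fun l => W.b u l = 0) (chartExponent q c d) with hM
  have hbc : W.b u c = 0 := by rw [← hc]; exact W.onExc u
  -- the coefficient of `M` in the translated chart transform is the single term of `d`
  have hsum : coeff M (PointBlowup.translate (W.b u) (chartTransform q c (W.st u).F)) =
      coeff M (PointBlowup.translate (W.b u) (monomial (chartExponent q c d) (coeff d (W.st u).F))) := by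
    rw [translate_chartTransform_eq_sum, coeff_sum]
    refine Finset.sum_eq_single d (fun e he hne => ?_) (fun h => absurd hd h)
    by_contra hz
    refine hne (huniq e he fun l hl => ?_)
    have h1 := apply_eq_of_coeff_translate_monomial_ne_zero (W.b u) hl hz
    rw [← h1, hM, Finsupp.filter_apply, if_pos hl]
  have hone : coeff M (PointBlowup.translate (W.b u) (monomial (chartExponent q c d) (coeff d (W.st u).F))) =
      coeff d (W.st u).F * coeff M (PointBlowup.translate (W.b u) (monomial (chartExponent q c d) (1 : K))) := by
    have : monomial (chartExponent q c d) (coeff d (W.st u).F) =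
        C (coeff d (W.st u).F) * monomial (chartExponent q c d) (1 : K) := by
      rw [C_mul_monomial, mul_one]
    rw [this]
    unfold PointBlowup.translate
    rw [map_mul, aeval_C, MvPolynomial.algebraMap_eq, coeff_C_mul]
  have hne : coeff M (W.st (u + 1)).F ≠ 0 := by
    rw [st_succ_F, hc, coeff_deletePthPowers, if_neg hnP, hsum, hone]
    exact mul_ne_zero (mem_support_iff.mp hd)
      (mem_support_iff.mp (filter_mem_support_translate_monomial (W.b u) hbc (chartExponent q c d)))
  exact ord_le_degree_of_mem_support W (u + 1) ho' (mem_support_iff.mpr hne)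

end Layer

end Summit.ResolutionOfSingularities.ResolutionOfSingularities.Theorems.WallCutRun
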